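import Summits.QuantumFields.YangMills.Theorems.BalabanUVNodesN15KingModelPotentialComplex
import Summits.QuantumFields.YangMills.Theorems.BalabanUVNodesN15KingModelPotentialDressedCovDeriv
import Summits.QuantumFields.YangMills.Theorems.BalabanUVNodesN15KingModelVitaliDisc
import Mathlib.Analysis.Complex.RealDeriv

/-!
# N15 (NE2) King-model rung, PART 28f — THE COMPLEX DERIVATIVES AT REAL COUPLINGS ARE THE REAL FIRST VARIATIONS
# (the first Taylor coefficient of the complex-coupling edition IS first-order perturbation theory)

Tenth generation (g10) of the seat `pub-ymgap-dag-n15-d`, part 28f (on 28b `…PotentialComplex` and 9f `…PotentialDressedCovDeriv`).  Part 28b's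
Cauchy estimates bound ALL `z`-derivatives of King's effective Laplacian `Δ^{(k)}_{z·w}` and of the dressed covariances `C^{(k)}_z` at real
couplings, uniformly in the cutoff; parts 8d and 9f computed the REAL first derivatives: `d∕dt Δ^{(k)}_{t·w}(b,b′)|₀ = potLevel w (b,b′)` (the
`ℋwℋ` sandwich = King's first variation, 8a∕8d `hasDerivAt_kingLevelPot_apply`) and `d∕dt C^{(j)}_{t·v}(x,y) = −(C D_t C)(x,y)` (9f
`hasDerivAt_kingCovPot_smul`).  This file identifies the two: the COMPLEX derivative at a real coupling of a function that is real-analytic data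
read over ℂ is the real derivative read over ℂ (`hasDerivAt_complex_of_real_slice`, uniqueness of the `ℝ → ℂ` derivative of the restriction), hence

* ★ `hasDerivAt_kingLevelPotC_zero`: `HasDerivAt (z ↦ Δ^{(k)}_{z·w}(b,b′)) (potLevel w (b,b′)) 0` — the first Taylor coefficient of the level in the
  complex coupling IS King's first variation `N^{−(d+1)}Σ_x ℋ_k(x,b)w(x)ℋ_k(x,b′)`;
* ★ `vitali_disc_iteratedDeriv` (generic, on 28c): under Vitali's hypotheses ALL iterated derivatives converge locally uniformly on the disc,
  `iteratedDeriv n (f_k) → iteratedDeriv n (vitaliLim f)` — with 28d(ii) every φ²-perturbation coefficient of `C^{(k)}_{z·v}(x,y)` converges to the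
  corresponding coefficient of the continuum-limit covariance;
* ★ `hasDerivAt_kingCovPotC_real`: at every real coupling `t` of 9f's window that also lies in the complex window,
  `HasDerivAt (z ↦ C^{(j)}_{z·v}(x,y)) (−(C^{(j)}_{tv}·D^{(j)}_t·C^{(j)}_{tv})(x,y)) (t : ℂ)` — the complex derivative is 9f's real one; in particular
  at `t = 0` the first `z`-Taylor coefficient of the dressed covariance is the first-order perturbation `−C^{(j)}·δΔ^{(j)}[v]·C^{(j)}`, whose size 28b's
  `norm_iteratedDeriv_kingCovPotC_le` (n = 1) bounds uniformly in the cutoff.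

PRINTED ANCHOR (template). [B9] = T. Bałaban, Commun. Math. Phys. **99** (1985) 389–434, Theorem 3.4 p. 400, (3.64)–(3.65) p. 402 (the analytic
extension and its first-order term); King's model: C. King, Commun. Math. Phys. **102** (1986) 649–677, (2.13)–(2.15) p. 653, (4.39)–(4.41)
pp. 674–675 (A = 0).

HONEST SCOPE.  King's A = 0 SCALAR model (any unit torus, `L ≥ 2`, `a, m² > 0`); real potentials × complex coupling; elementary calculus
(uniqueness of derivatives) over parts 8d∕9f∕28b; NOT Bałaban's `U′U`; NOT a node discharge; count-neutral.  No `sorry`, standard axioms.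
-/

noncomputable section

open scoped BigOperators Matrix
open Finset Filter Topology Metric

namespace Summit.QuantumFields.YangMills.BalabanUVNodes.N15.KingModel

open Literature.MathematicalPhysics.QuantumFieldTheory.Balaban1983to89 hiding blockOf
open Literature.MathematicalPhysics.QuantumFieldTheory.Balaban1983to89.B5Prop11Plancherel (Tor fine)
open Literature.MathematicalPhysics.QuantumFieldTheory.King1986 (aK aK_pos)
open Literature.MathematicalPhysics.QuantumFieldTheory.King1986.Torus (Qmat)

variable {d : ℕ}

/-! ## §1 The complex derivative at a real point of a real slice -/

/-- **Uniqueness device**: if `g : ℂ → ℂ` is ℂ-differentiable at the real point `t`, agrees with `s ↦ (f s : ℂ)` on the real axis, and `f` has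
real derivative `f′` at `t`, then `HasDerivAt g (f′ : ℂ) (t : ℂ)` (restrict `g` to `ℝ` with `HasDerivAt.comp_ofReal`, compare with
`HasDerivAt.ofReal_comp`, uniqueness of the `ℝ → ℂ` derivative). [folklore] -/
theorem hasDerivAt_complex_of_real_slice {g : ℂ → ℂ} {f : ℝ → ℝ} {f' t : ℝ} (hg : DifferentiableAt ℂ g (t : ℂ))
    (hslice : ∀ s : ℝ, g (s : ℂ) = (f s : ℂ)) (hf : HasDerivAt f f' t) : HasDerivAt g (f' : ℂ) (t : ℂ) := by
  have h1 : HasDerivAt (fun y : ℝ => g (y : ℂ)) (deriv g (t : ℂ)) t := hg.hasDerivAt.comp_ofReal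
  have h2 : HasDerivAt (fun y : ℝ => g (y : ℂ)) (f' : ℂ) t := by
    have h := hf.ofReal_comp
    refine h.congr_of_eventuallyEq (Filter.Eventually.of_forall fun s => ?_)
    exact hslice s
  have heq : deriv g (t : ℂ) = (f' : ℂ) := h1.unique h2
  rw [← heq]
  exact hg.hasDerivAt


/-- ★ **ALL ITERATED DERIVATIVES CONVERGE** under the hypotheses of 28c's `vitali_disc` (`f_k` holomorphic on `ball 0 R`, `‖f_k‖ ≤ C`, convergent at
the real couplings `0 < t < ρ`): for every `n`, `iteratedDeriv n (f_k) → iteratedDeriv n (vitaliLim f)` locally uniformly and pointwise on the ball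
(induction on `n` with Mathlib's `TendstoLocallyUniformlyOn.deriv`; every `iteratedDeriv n (f_k)` is holomorphic on the open ball). [folklore] -/
theorem vitali_disc_iteratedDeriv {f : ℕ → ℂ → ℂ} {R C ρ : ℝ} (hR : 0 < R) (hρ : 0 < ρ) (hd : ∀ k, DifferentiableOn ℂ (f k) (ball 0 R))
    (hb : ∀ k, ∀ z ∈ ball 0 R, ‖f k z‖ ≤ C) (hconv : ∀ t : ℝ, 0 < t → t < ρ → ∃ l : ℂ, Tendsto (fun k => f k (t : ℂ)) atTop (𝓝 l)) (n : ℕ) :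
    TendstoLocallyUniformlyOn (fun k => iteratedDeriv n (f k)) (iteratedDeriv n (vitaliLim f)) atTop (ball 0 R) ∧
      ∀ z ∈ ball 0 R, Tendsto (fun k => iteratedDeriv n (f k) z) atTop (𝓝 (iteratedDeriv n (vitaliLim f) z)) := by
  have hdn : ∀ n k, DifferentiableOn ℂ (iteratedDeriv n (f k)) (ball 0 R) := by
    intro n
    induction n with
    | zero => intro k; rw [iteratedDeriv_zero]; exact hd k
    | succ n ih =>
      intro k
      rw [iteratedDeriv_succ]
      exact (((ih k).analyticOnNhd isOpen_ball).deriv).differentiableOn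
  have hloc : TendstoLocallyUniformlyOn (fun k => iteratedDeriv n (f k)) (iteratedDeriv n (vitaliLim f)) atTop (ball 0 R) := by
    induction n with
    | zero => simpa only [iteratedDeriv_zero] using (vitali_disc hR hρ hd hb hconv).2.1
    | succ n ih =>
      have h := ih.deriv (Eventually.of_forall (hdn n)) isOpen_ball
      simpa only [iteratedDeriv_succ, Function.comp_def] using h
  exact ⟨hloc, fun z hz => hloc.tendsto_at hz⟩

/-! ## §2 The first Taylor coefficient of the level is King's first variation -/

section Level

variable {a m2 : ℝ} {L : ℕ} [NeZero L] {M : Fin (d + 1) → ℕ} [∀ μ, NeZero (M μ)]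

/-- ★ **THE COMPLEX DERIVATIVE OF `z ↦ Δ^{(k)}_{z·w}(b,b′)` AT `0` IS `potLevel w (b,b′)`** — the `ℋwℋ` sandwich `N^{−(d+1)}Σ_x ℋ_k(x,b)w(x)ℋ_k(x,b′)`
(8d's real `hasDerivAt_kingLevelPot_apply` lifted by the uniqueness device; `L ≥ 2`, `a, m² > 0`, `k ≥ 1`, any potential `w`).
[cite: King1986, (2.13)–(2.15) p.653, (4.39) p.674, (4.40) p.675 (A = 0)] -/
theorem hasDerivAt_kingLevelPotC_zero (hL : 2 ≤ L) (ha : 0 < a) (hm : 0 < m2) {k : ℕ} (hk : 1 ≤ k)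
    (w : Tor (fine (L ^ k) (fine L M)) → ℝ) (b b' : Tor (fine L M)) :
    HasDerivAt (fun z : ℂ => kingLevelPotC d a m2 L M k z w b b') ((potLevel L (fine L M) a m2 (L ^ k) k w b b' : ℝ) : ℂ) 0 := by
  have hLr : (1 : ℝ) < L := by exact_mod_cast (by omega : 1 < L)
  have haK := aK_pos ha hLr hk
  -- a bound on `w` (any finite sup works) and differentiability at `0`
  set w₀ : ℝ := ∑ x, |w x| with hw₀
  have hw : ∀ x, |w x| ≤ w₀ := fun x => single_le_sum (f := fun x => |w x|) (fun _ _ => abs_nonneg _) (mem_univ x)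
  have hz : ‖(0 : ℂ)‖ * w₀ < m2 := by rw [norm_zero, zero_mul]; exact hm
  have hdiff : DifferentiableAt ℂ (fun z : ℂ => kingLevelPotC d a m2 L M k z w b b') ((0 : ℝ) : ℂ) := by
    rw [Complex.ofReal_zero]
    exact differentiableAt_effLaplacianPotC_apply haK.le (by positivity) hw hz b b'
  have h := hasDerivAt_complex_of_real_slice hdiff (f := fun s : ℝ => kingLevelPot a m2 L M k (s • w) b b')
    (fun s => by rw [kingLevelPotC_ofReal, Matrix.map_apply]) (hasDerivAt_kingLevelPot_apply hL ha hm hk w b b')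
  rwa [Complex.ofReal_zero] at h

/-- The same as a `deriv` identity. [folklore] -/
theorem deriv_kingLevelPotC_zero (hL : 2 ≤ L) (ha : 0 < a) (hm : 0 < m2) {k : ℕ} (hk : 1 ≤ k)
    (w : Tor (fine (L ^ k) (fine L M)) → ℝ) (b b' : Tor (fine L M)) :
    deriv (fun z : ℂ => kingLevelPotC d a m2 L M k z w b b') 0 = ((potLevel L (fine L M) a m2 (L ^ k) k w b b' : ℝ) : ℂ) :=
  (hasDerivAt_kingLevelPotC_zero hL ha hm hk w b b').deriv

end Level

/-! ## §3 The complex derivative of the dressed covariance at a real coupling is 9f's -/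

section Cov

variable {a m2 : ℝ} {L : ℕ} [NeZero L] {M : Fin (d + 1) → ℕ} [∀ μ, NeZero (M μ)]

/-- ★ **THE COMPLEX DERIVATIVE OF `z ↦ C^{(j)}_{z·v}(x,y)` AT A REAL COUPLING IS 9f's REAL DERIVATIVE** `−(C^{(j)}_{tv}·D^{(j)}_t·C^{(j)}_{tv})(x,y)`:
for `L ≥ 2`, `a, m² > 0`, a potential tower with `sup|v| ≤ w₁`, a real coupling `|t| < T` inside 9f's window (`T·w₁ ≤ w̄`, `c_E(T·w₁) ≤ c̄`) that ALSO
lies in 28b's complex window (`|t|·w₁ ≤ r_K`), and a level `j ≥ 1`.  At `t = 0` this says: the first `z`-Taylor coefficient of the dressed covariance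
is first-order perturbation theory `−C^{(j)}·δΔ^{(j)}[v]·C^{(j)}`. [cite: King1986, (4.32) p.674, (4.39)–(4.40) pp.674–675 (A = 0); Balaban1985BackgroundPropagators, (3.64)–(3.65) p.402 (template)] -/
theorem hasDerivAt_kingCovPotC_real (ha : 0 < a) (hm : 0 < m2) (hL : 2 ≤ L) {v : ∀ N : ℕ, Tor (fine N (fine L M)) → ℝ} {w₁ T t : ℝ}
    (hw₁ : 0 ≤ w₁) (hv : ∀ N x, |v N x| ≤ w₁) (ht : |t| < T) (hT0 : 0 ≤ T) (hTw : T * w₁ ≤ wbarK (d + 1) a L)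
    (hsmall : a ^ 2 * ctCK (d + 1) a L ^ 2 * kwSum (d + 1) a L * (T * w₁) ≤ kingCbar (d + 1) a L)
    (htc : |t| * w₁ ≤ cplxWindow d a m2 L) {j : ℕ} (hj : 1 ≤ j) (x y : Tor (fine L M)) :
    HasDerivAt (fun z : ℂ => kingCovPotC d a m2 L M j z (v (L ^ j)) x y)
      (((-(((kingTowerPot a m2 L M (t • v) j + kingBlock a L M)⁻¹
        * ((aK a L (max j 1) ^ 2 * ((L ^ max j 1 : ℕ) : ℝ) ^ (d + 1)) • (Qmat (L ^ max j 1) (fine L M)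
            * ((fineOpPot (L ^ max j 1) (fine L M) (aK a L (max j 1)) (((L ^ max j 1 : ℕ) : ℝ) ^ 2) m2 (t • v (L ^ max j 1)))⁻¹
              * Matrix.diagonal (v (L ^ max j 1))
              * (fineOpPot (L ^ max j 1) (fine L M) (aK a L (max j 1)) (((L ^ max j 1 : ℕ) : ℝ) ^ 2) m2 (t • v (L ^ max j 1)))⁻¹)
            * (Qmat (L ^ max j 1) (fine L M))ᵀ))
        * (kingTowerPot a m2 L M (t • v) j + kingBlock a L M)⁻¹) x y)) : ℝ) : ℂ) (t : ℂ) := by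
  have hreal := hasDerivAt_kingCovPot_smul (M := M) ha hm hL hv ht hT0 hTw hsmall j x y
  have htc' : ‖(t : ℂ)‖ * w₁ ≤ cplxWindow d a m2 L := by rwa [Complex.norm_real, Real.norm_eq_abs]
  have hdiff : DifferentiableAt ℂ (fun z : ℂ => kingCovPotC d a m2 L M j z (v (L ^ j)) x y) (t : ℂ) :=
    differentiableAt_kingCovPotC_apply ha hm hL hj hw₁ (hv _) htc' x y
  refine hasDerivAt_complex_of_real_slice hdiff (fun s => ?_) hreal
  rw [kingCovPotC_ofReal, kingTowerPot_of_one_le _ hj, Matrix.map_apply]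
  rfl

end Cov

end Summit.QuantumFields.YangMills.BalabanUVNodes.N15.KingModel

end
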